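import Mathlib.Analysis.Calculus.ContDiff.Operations
import Mathlib.LinearAlgebra.Matrix.NonsingularInverse
import HarnessLib

/-!
# Smoothness of the determinant, adjugate and inverse of a matrix field

Topic `Literature/Analysis/Calculus` (companion of `MatrixFieldDeriv.lean`, which differentiates
`y ↦ (G y)⁻¹`, `det (G y)` once). For a field of matrices `A : E → Matrix ι ι ℝ` whose entries are
`C^n` on a set `s`, the determinant (a polynomial in the entries), the adjugate (determinants of
row-updated matrices) and — where `det A ≠ 0` — the entries of the inverse
`A⁻¹ = (det A)⁻¹ • adj A` are `C^n` on `s` (`ContDiffOn.matrix_det`, `.matrix_adjugate`,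
`.matrix_inv`). Used for the inverse metric `gⁱʲ` and the Christoffel symbols of a smooth metric
read in a chart (`Literature/Geometry/Lorentzian/ChartLaplacian.lean`: `Ĝ` is smooth on the chart
target with `det Ĝ ≠ 0`). Everything is proved; no named facts. [folklore]

## References

* J. R. Magnus, H. Neudecker, *Matrix Differential Calculus*, 3rd ed. 2019, Ch. 8
  (differentials of `det`, `adj`, `X⁻¹`). [MagnusNeudecker2019]
-/

noncomputable section

open Matrix Set

namespace Literature.Analysis.Calculus

variable {E : Type*} [NormedAddCommGroup E] [NormedSpace ℝ E] {ι : Type*} [Fintype ι]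
  [DecidableEq ι] {n : WithTop ℕ∞} {s : Set E}

/-- **The determinant of a matrix field with `C^n` entries is `C^n`** (Leibniz expansion).
[folklore] -/
theorem ContDiffOn.matrix_det {A : E → Matrix ι ι ℝ} (hA : ∀ i j, ContDiffOn ℝ n (fun y => A y i j) s) :
    ContDiffOn ℝ n (fun y => (A y).det) s := by
  have heq : (fun y => (A y).det) =
      fun y => ∑ σ : Equiv.Perm ι, ((Equiv.Perm.sign σ : ℤ) : ℝ) * ∏ i, A y (σ i) i := by
    funext y
    rw [Matrix.det_apply]
    refine Finset.sum_congr rfl fun σ _ => ?_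
    rw [Units.smul_def, zsmul_eq_mul]
  rw [heq]
  exact ContDiffOn.sum fun σ _ => contDiffOn_const.mul (contDiffOn_prod fun i _ => hA (σ i) i)

/-- **The adjugate of a matrix field with `C^n` entries has `C^n` entries**
(`adj A i j = det (A with row j replaced by eᵢ)`). [folklore] -/
theorem ContDiffOn.matrix_adjugate {A : E → Matrix ι ι ℝ}
    (hA : ∀ i j, ContDiffOn ℝ n (fun y => A y i j) s) (i j : ι) :
    ContDiffOn ℝ n (fun y => (A y).adjugate i j) s := by
  simp only [Matrix.adjugate_apply]
  refine ContDiffOn.matrix_det (A := fun y => (A y).updateRow j (Pi.single i 1)) fun a c => ?_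
  by_cases h : a = j
  · subst h
    simp only [Matrix.updateRow_self]
    exact contDiffOn_const
  · simp only [Matrix.updateRow_ne h]
    exact hA a c

/-- **The inverse of a matrix field with `C^n` entries and nonvanishing determinant has `C^n`
entries** (`A⁻¹ = (det A)⁻¹ • adj A`). [folklore] -/
theorem ContDiffOn.matrix_inv {A : E → Matrix ι ι ℝ} (hA : ∀ i j, ContDiffOn ℝ n (fun y => A y i j) s)
    (hdet : ∀ y ∈ s, (A y).det ≠ 0) (i j : ι) :
    ContDiffOn ℝ n (fun y => (A y)⁻¹ i j) s := by
  have heq : ∀ y ∈ s, (A y)⁻¹ i j = (A y).adjugate i j / (A y).det := by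
    intro y _
    rw [Matrix.inv_def, Ring.inverse_eq_inv, Matrix.smul_apply, smul_eq_mul, div_eq_inv_mul]
  exact ((ContDiffOn.matrix_adjugate hA i j).div (ContDiffOn.matrix_det hA) hdet).congr heq

/-- Version for fields given entrywise (`A y = Matrix.of (a y)`). [folklore] -/
theorem ContDiffOn.matrix_of_inv {a : E → ι → ι → ℝ} (ha : ∀ i j, ContDiffOn ℝ n (fun y => a y i j) s)
    (hdet : ∀ y ∈ s, (Matrix.of (a y)).det ≠ 0) (i j : ι) :
    ContDiffOn ℝ n (fun y => (Matrix.of (a y))⁻¹ i j) s :=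
  ContDiffOn.matrix_inv (A := fun y => Matrix.of (a y)) (fun i j => by simpa using ha i j) hdet i j

end Literature.Analysis.Calculus

end
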